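import Mathlib
import HarnessLib
import Summits.Ventures.LatticeQCDFlow.Scaling.LossDiagonalRate
import Summits.Ventures.LatticeQCDFlow.Scaling.TiltKLDivergence

/-!
# LatticeQCDFlow / Scaling — the UNIVERSAL LOSS LAW: for heterogeneous and triangular factorised
# samplers the total training loss on the diagonal converges to `s/2 = c²σ²/2` as well

HONEST FRAMING: exact (Metropolis-corrected) sampling algorithms for lattice gauge theory;
figures of merit are autocorrelation/cost numbers at stated couplings and volumes; no
continuum-physics claim.

Venture `LatticeQCDFlow` (cell pub-lqcd), topic `Scaling`; FANOUT row 3 (`s0-u1-a`, S0-B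
implementation A, GEN-20).  NEW WORK of the cell — on row 3's `Scaling/LossDiagonalRate` (the
block-uniform rate `|cgf(u) − u²σ²/2| ≤ 2|u|³K³`) and `Scaling/TiltKLDivergence` (the reverse loss of
a tilt is `cgf(t) − t·E X`), with Mathlib's `iIndepFun.cgf_sum` on `Measure.pi`; NO definition is
introduced; nothing is cited.  Row 3's GEN-19 `Scaling/HeterogeneousUniversality` and
`Scaling/LogNormalUniversality` proved the ACCEPTANCE side (`→` the log-normal law with `s = c²σ²`)
for independent non-identical blocks (`n⁻¹ΣVarᵢ → σ²`) and for `n`-dependent blocks (`Var_n → σ²`);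
this file proves the LOSS side in the same settings, so the dictionary `acc = erfc(√(KL/2))` of
`Scaling/TiltKLDiagonalLimit` persists beyond identical blocks.

## Content (all `[ours]`)

§1 rows of INDEPENDENT NON-IDENTICAL blocks (laws `ρᵢ`, bounded measurable statistics `hᵢ`,
`T = Σᵢ hᵢ(yᵢ)` on `(Fin n → Y, ⊗ρᵢ)`): `heteroPi_cgf_sum` (`cgf_T = Σᵢ cgf_{hᵢ}`),
`heteroPi_integral_sum`, **`toReal_klDiv_heteroPi_tilted_right`** (the reverse loss
`KL(⊗ρᵢ ‖ (⊗ρᵢ).tilted(tT)) = Σᵢ (cgfᵢ(t) − t·Eᵢhᵢ)`).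
§2 **`abs_sum_cgf_sub_le`** (`|Σᵢ cgfᵢ(u) − u²ΣᵢVarᵢ/2| ≤ 2n|u|³K³`, centred blocks, `|u|K ≤ 1/2`),
**`heteroPi_loss_diag_tendsto`** (centred, `|h_{n,i}| ≤ K`, `n⁻¹ΣᵢVar_{n,i} → σ²` ⇒
`Σᵢ cgf_{n,i}(c/√n) → c²σ²/2`), **`heteroPi_klDiv_diag_tendsto`** (the same in `klDiv` form),
**`triangularPi_loss_diag_tendsto`** (`n`-dependent identical blocks, `Var_n → σ²` ⇒
`n·cgf_n(c/√n) → c²σ²/2`).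

Reading (value-free): whatever the block structure, the total reverse training loss of a factorised
exact sampler on the diagonal converges to half the limiting log-weight variance; with GEN-19's
acceptance universality the large-volume conversion `acc = erfc(√(KL/2))` holds for heterogeneous
and volume-dependent (e.g. trained, residual-mismatch `≍ V^{−1/2}`) factorised flows alike.
NOT CLAIMED: unbounded blocks; martingale (autoregressive) log-weights; rates for the acceptance;
any value at the cell's `(β, L)`; nothing re-scored.
-/

noncomputable section

namespace Summit.Ventures.LatticeQCDFlow.Theory2

open MeasureTheory ProbabilityTheory InformationTheory Filter Finset Real Set
open scoped Topology NNReal ENNReal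

/-! ## §1 Heterogeneous rows: `cgf_T = Σᵢ cgfᵢ` and the reverse loss -/

section Hetero

variable {Y : Type*} {mY : MeasurableSpace Y}

/-- The row sum of bounded blocks is bounded: `|Σᵢ hᵢ(yᵢ)| ≤ n·K`. [ours] -/
theorem heteroPi_sum_mem_Icc {n : ℕ} {h : Fin n → Y → ℝ} {K : ℝ} (hK : ∀ i y, |h i y| ≤ K)
    (ρ : Fin n → Measure Y) :
    ∀ᵐ y ∂(Measure.pi ρ), (∑ i, h i (y i)) ∈ Set.Icc (-(n * K)) (n * K) := by
  refine ae_of_all _ fun y => abs_le.1 ?_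
  calc |∑ i, h i (y i)| ≤ ∑ i, |h i (y i)| := Finset.abs_sum_le_sum_abs _ _
    _ ≤ ∑ _i : Fin n, K := Finset.sum_le_sum fun i _ => hK i _
    _ = n * K := by simp

/-- **`cgf_T = Σᵢ cgf_{hᵢ}`** for the row sum of independent non-identical bounded blocks. [ours] -/
theorem heteroPi_cgf_sum {n : ℕ} (ρ : Fin n → Measure Y) [∀ i, IsProbabilityMeasure (ρ i)]
    {h : Fin n → Y → ℝ} (hm : ∀ i, Measurable (h i)) {K : ℝ} (hK : ∀ i y, |h i y| ≤ K) (t : ℝ) :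
    cgf (fun y : Fin n → Y => ∑ i, h i (y i)) (Measure.pi ρ) t = ∑ i, cgf (h i) (ρ i) t := by
  have hind : iIndepFun (fun (i : Fin n) (y : Fin n → Y) => h i (y i)) (Measure.pi ρ) :=
    iIndepFun_pi fun i => (hm i).aemeasurable
  have hgb : ∀ i, ∀ᵐ y ∂ρ i, h i y ∈ Set.Icc (-K) K := fun i => ae_of_all _ fun y => abs_le.1 (hK i y)
  have hlaw : ∀ i : Fin n, (Measure.pi ρ).map (Function.eval i) = ρ i := fun i =>
    (measurePreserving_eval ρ i).map_eq
  have hint : ∀ i : Fin n, Integrable (fun y : Fin n → Y => Real.exp (t * h i (y i))) (Measure.pi ρ) := by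
    intro i
    have h1 : Integrable (fun y => Real.exp (t * h i y)) ((Measure.pi ρ).map (Function.eval i)) := by
      rw [hlaw]; exact integrable_exp_mul_of_mem_Icc (hm i).aemeasurable (hgb i)
    exact h1.comp_measurable (measurable_pi_apply i)
  have hs := hind.cgf_sum (fun i => (hm i).comp (measurable_pi_apply i)) (s := Finset.univ)
    (fun i _ => hint i) (t := t)
  have e : (∑ i ∈ (Finset.univ : Finset (Fin n)), fun y : Fin n → Y => h i (y i))
      = fun y => ∑ i, h i (y i) := by
    funext y; simp [Finset.sum_apply]
  rw [e] at hs
  have hmarg : ∀ i : Fin n, cgf (fun y : Fin n → Y => h i (y i)) (Measure.pi ρ) t = cgf (h i) (ρ i) t :=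
    fun i => by
    simp only [cgf]
    congr 1
    have hm' := mgf_map (μ := Measure.pi ρ) (Y := Function.eval i) (X := h i)
      (measurable_pi_apply i).aemeasurable (t := t)
      (by rw [hlaw]; exact (Real.measurable_exp.comp (measurable_const.mul (hm i))).aestronglyMeasurable)
    rw [hlaw] at hm'
    rw [hm']
    rfl
  rw [hs]
  exact Finset.sum_congr rfl fun i _ => hmarg i

/-- `E[Σᵢ hᵢ(yᵢ)] = Σᵢ Eᵢ hᵢ`. [ours] -/
theorem heteroPi_integral_sum {n : ℕ} (ρ : Fin n → Measure Y) [∀ i, IsProbabilityMeasure (ρ i)]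
    {h : Fin n → Y → ℝ} (hm : ∀ i, Measurable (h i)) {K : ℝ} (hK : ∀ i y, |h i y| ≤ K) :
    ∫ y, ∑ i, h i (y i) ∂(Measure.pi ρ) = ∑ i, ∫ y, h i y ∂(ρ i) := by
  have hgb : ∀ i, ∀ᵐ y ∂ρ i, h i y ∈ Set.Icc (-K) K := fun i => ae_of_all _ fun y => abs_le.1 (hK i y)
  have hlaw : ∀ i : Fin n, (Measure.pi ρ).map (Function.eval i) = ρ i := fun i =>
    (measurePreserving_eval ρ i).map_eq
  have hint : ∀ i : Fin n, Integrable (fun y : Fin n → Y => h i (y i)) (Measure.pi ρ) := by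
    intro i
    have h1 : Integrable (h i) ((Measure.pi ρ).map (Function.eval i)) := by
      rw [hlaw]; exact Integrable.of_mem_Icc (-K) K (hm i).aemeasurable (hgb i)
    exact h1.comp_measurable (measurable_pi_apply i)
  rw [integral_finsetSum _ fun i _ => hint i]
  refine Finset.sum_congr rfl fun i _ => ?_
  have := integral_map (μ := Measure.pi ρ) (φ := Function.eval i) (measurable_pi_apply i).aemeasurable
    (f := h i) (by rw [hlaw]; exact (hm i).aestronglyMeasurable)
  rw [hlaw] at this
  rw [this]

/-- **THE REVERSE LOSS OF A HETEROGENEOUS FACTORISED SAMPLER**: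
`KL(⊗ρᵢ ‖ (⊗ρᵢ).tilted(t·Σᵢhᵢ)) = Σᵢ (cgfᵢ(t) − t·Eᵢhᵢ)`. [ours] -/
theorem toReal_klDiv_heteroPi_tilted_right {n : ℕ} (ρ : Fin n → Measure Y)
    [∀ i, IsProbabilityMeasure (ρ i)] {h : Fin n → Y → ℝ} (hm : ∀ i, Measurable (h i)) {K : ℝ}
    (hK : ∀ i y, |h i y| ≤ K) (t : ℝ) :
    (klDiv (Measure.pi ρ) ((Measure.pi ρ).tilted fun y => t * ∑ i, h i (y i))).toReal
      = ∑ i, (cgf (h i) (ρ i) t - t * ∫ y, h i y ∂(ρ i)) := by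
  have hTm : Measurable (fun y : Fin n → Y => ∑ i, h i (y i)) :=
    Finset.measurable_sum _ fun i _ => (hm i).comp (measurable_pi_apply i)
  have hTi : Integrable (fun y : Fin n → Y => ∑ i, h i (y i)) (Measure.pi ρ) :=
    Integrable.of_mem_Icc _ _ hTm.aemeasurable (heteroPi_sum_mem_Icc hK ρ)
  have hexp : Integrable (fun y : Fin n → Y => Real.exp (t * ∑ i, h i (y i))) (Measure.pi ρ) :=
    integrable_exp_mul_of_mem_Icc hTm.aemeasurable (heteroPi_sum_mem_Icc hK ρ)
  rw [toReal_klDiv_tilted_mul_right (X := fun y : Fin n → Y => ∑ i, h i (y i)) hTi hexp,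
    heteroPi_cgf_sum ρ hm hK, heteroPi_integral_sum ρ hm hK, Finset.mul_sum, ← Finset.sum_sub_distrib]

end Hetero

/-! ## §2 The universal loss law on the diagonal -/

section Universal

variable {Y : Type*} {mY : MeasurableSpace Y}

/-- **`|Σᵢ cgfᵢ(u) − u²·ΣᵢVarᵢ/2| ≤ 2n|u|³K³`** for centred blocks bounded by `K`, `|u|K ≤ 1/2` — the
rate of `Scaling/LossDiagonalRate` is uniform in the block, so it sums. [ours] -/
theorem abs_sum_cgf_sub_le {n : ℕ} (ρ : Fin n → Measure Y) [∀ i, IsProbabilityMeasure (ρ i)]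
    {h : Fin n → Y → ℝ} (hm : ∀ i, Measurable (h i)) {K : ℝ} (hK : ∀ i y, |h i y| ≤ K)
    (h0 : ∀ i, ∫ y, h i y ∂(ρ i) = 0) {u : ℝ} (hu : |u| * K ≤ 1 / 2) :
    |∑ i, cgf (h i) (ρ i) u - u ^ 2 * (∑ i, Var[h i; ρ i]) / 2| ≤ 2 * n * |u| ^ 3 * K ^ 3 := by
  have e : ∑ i, cgf (h i) (ρ i) u - u ^ 2 * (∑ i, Var[h i; ρ i]) / 2
      = ∑ i, (cgf (h i) (ρ i) u - u ^ 2 * Var[h i; ρ i] / 2) := by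
    rw [Finset.sum_sub_distrib, Finset.mul_sum, Finset.sum_div]
  rw [e]
  calc |∑ i, (cgf (h i) (ρ i) u - u ^ 2 * Var[h i; ρ i] / 2)|
      ≤ ∑ i, |cgf (h i) (ρ i) u - u ^ 2 * Var[h i; ρ i] / 2| := Finset.abs_sum_le_sum_abs _ _
    _ ≤ ∑ _i : Fin n, 2 * |u| ^ 3 * K ^ 3 :=
        Finset.sum_le_sum fun i _ => abs_cgf_sub_le (ρ i) (hm i) (hK i) (h0 i) hu
    _ = 2 * n * |u| ^ 3 * K ^ 3 := by simp; ring

variable {ρ : (n : ℕ) → Fin n → Measure Y} [∀ n i, IsProbabilityMeasure (ρ n i)]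
  {h : (n : ℕ) → Fin n → Y → ℝ}

/-- **THE UNIVERSAL LOSS LAW (heterogeneous rows)**: independent non-identical centred blocks with
`|h_{n,i}| ≤ K` and `n⁻¹ΣᵢVar_{n,i} → σ²`: on the diagonal `Σᵢ cgf_{n,i}(c/√n) → c²σ²/2` — the total
reverse training loss converges to `s/2`, as for identical blocks. [ours] -/
theorem heteroPi_loss_diag_tendsto (hm : ∀ n i, Measurable (h n i)) {K : ℝ}
    (hK : ∀ n i y, |h n i y| ≤ K) (h0 : ∀ n i, ∫ y, h n i y ∂ρ n i = 0) {σ2 : ℝ}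
    (hσ : Tendsto (fun n : ℕ => (∑ i, Var[h n i; ρ n i]) / n) atTop (𝓝 σ2)) (c : ℝ) :
    Tendsto (fun n : ℕ => ∑ i, cgf (h n i) (ρ n i) (c / Real.sqrt n)) atTop
      (𝓝 (c ^ 2 * σ2 / 2)) := by
  -- main term `(c²/2)·(ΣVar/n) → c²σ²/2`, error `≤ 2|c|³K³/√n → 0`
  have hmain : Tendsto (fun n : ℕ => c ^ 2 * ((∑ i, Var[h n i; ρ n i]) / n) / 2) atTop
      (𝓝 (c ^ 2 * σ2 / 2)) := (hσ.const_mul (c ^ 2)).div_const 2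
  have herr : Tendsto (fun n : ℕ => 2 * |c| ^ 3 * K ^ 3 / Real.sqrt n) atTop (𝓝 0) := by
    have := (tendsto_inv_atTop_zero.comp
      (Real.tendsto_sqrt_atTop.comp tendsto_natCast_atTop_atTop)).const_mul (2 * |c| ^ 3 * K ^ 3)
    simpa [div_eq_mul_inv] using this
  have hlo := hmain.sub herr
  have hhi := hmain.add herr
  rw [sub_zero] at hlo
  rw [add_zero] at hhi
  -- eventually `|c|K/√n ≤ 1/2`
  have hev : ∀ᶠ n : ℕ in atTop, |c / Real.sqrt n| * K ≤ 1 / 2 ∧ 0 < n := by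
    have hK0 : ∀ᶠ n : ℕ in atTop, |c| * K / Real.sqrt n ≤ 1 / 2 := by
      have ht : Tendsto (fun n : ℕ => |c| * K / Real.sqrt n) atTop (𝓝 0) := by
        have := (tendsto_inv_atTop_zero.comp
          (Real.tendsto_sqrt_atTop.comp tendsto_natCast_atTop_atTop)).const_mul (|c| * K)
        simpa [div_eq_mul_inv] using this
      exact ((tendsto_order.1 ht).2 (1 / 2) (by norm_num)).mono fun n hn => hn.le
    filter_upwards [hK0, eventually_gt_atTop 0] with n hn hn0
    have hs : 0 < Real.sqrt n := Real.sqrt_pos.2 (Nat.cast_pos.2 hn0)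
    refine ⟨?_, hn0⟩
    rw [abs_div, abs_of_pos hs, div_mul_eq_mul_div]
    exact hn
  refine tendsto_of_tendsto_of_tendsto_of_le_of_le' hlo hhi ?_ ?_
  · filter_upwards [hev] with n ⟨hn, hn0⟩
    have hs : 0 < Real.sqrt n := Real.sqrt_pos.2 (Nat.cast_pos.2 hn0)
    have hb := abs_sum_cgf_sub_le (ρ n) (hm n) (hK n) (h0 n) hn
    have e1 : (c / Real.sqrt n) ^ 2 * (∑ i, Var[h n i; ρ n i]) / 2
        = c ^ 2 * ((∑ i, Var[h n i; ρ n i]) / n) / 2 := by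
      rw [div_pow, Real.sq_sqrt (Nat.cast_nonneg n)]; ring
    have e2 : 2 * (n : ℝ) * |c / Real.sqrt n| ^ 3 * K ^ 3 = 2 * |c| ^ 3 * K ^ 3 / Real.sqrt n := by
      rw [abs_div, abs_of_pos hs, div_pow]
      have hn3 : Real.sqrt n ^ 3 = n * Real.sqrt n := by
        rw [pow_succ, Real.sq_sqrt (Nat.cast_nonneg n)]
      rw [hn3]; field_simp
    rw [e1, e2] at hb
    linarith [(abs_le.1 hb).1]
  · filter_upwards [hev] with n ⟨hn, hn0⟩
    have hs : 0 < Real.sqrt n := Real.sqrt_pos.2 (Nat.cast_pos.2 hn0)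
    have hb := abs_sum_cgf_sub_le (ρ n) (hm n) (hK n) (h0 n) hn
    have e1 : (c / Real.sqrt n) ^ 2 * (∑ i, Var[h n i; ρ n i]) / 2
        = c ^ 2 * ((∑ i, Var[h n i; ρ n i]) / n) / 2 := by
      rw [div_pow, Real.sq_sqrt (Nat.cast_nonneg n)]; ring
    have e2 : 2 * (n : ℝ) * |c / Real.sqrt n| ^ 3 * K ^ 3 = 2 * |c| ^ 3 * K ^ 3 / Real.sqrt n := by
      rw [abs_div, abs_of_pos hs, div_pow]
      have hn3 : Real.sqrt n ^ 3 = n * Real.sqrt n := by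
        rw [pow_succ, Real.sq_sqrt (Nat.cast_nonneg n)]
      rw [hn3]; field_simp
    rw [e1, e2] at hb
    linarith [(abs_le.1 hb).2]

/-- **THE UNIVERSAL LOSS LAW in `klDiv` form**: for heterogeneous centred blocks as above, the
reverse training loss `KL(⊗ᵢρ_{n,i} ‖ (⊗ᵢρ_{n,i}).tilted((c/√n)·Σᵢh_{n,i})) → c²σ²/2`. [ours] -/
theorem heteroPi_klDiv_diag_tendsto (hm : ∀ n i, Measurable (h n i)) {K : ℝ}
    (hK : ∀ n i y, |h n i y| ≤ K) (h0 : ∀ n i, ∫ y, h n i y ∂ρ n i = 0) {σ2 : ℝ}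
    (hσ : Tendsto (fun n : ℕ => (∑ i, Var[h n i; ρ n i]) / n) atTop (𝓝 σ2)) (c : ℝ) :
    Tendsto (fun n : ℕ => (klDiv (Measure.pi (ρ n))
        ((Measure.pi (ρ n)).tilted fun y => c / Real.sqrt n * ∑ i, h n i (y i))).toReal) atTop
      (𝓝 (c ^ 2 * σ2 / 2)) := by
  refine (heteroPi_loss_diag_tendsto hm hK h0 hσ c).congr fun n => ?_
  rw [toReal_klDiv_heteroPi_tilted_right (ρ n) (hm n) (hK n)]
  simp [h0 n]

end Universal

/-! ## §3 Triangular arrays: `n`-dependent identical blocks -/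

section Triangular

variable {Y : Type*} {mY : MeasurableSpace Y} {ρ : ℕ → Measure Y} [∀ n, IsProbabilityMeasure (ρ n)]
  {h : ℕ → Y → ℝ}

/-- **THE UNIVERSAL LOSS LAW (triangular arrays)**: `n`-dependent block law `ρ_n` and bounded centred
statistic `h_n` (`|h_n| ≤ K`) with `Var_n → σ²`: `n·cgf_n(c/√n) → c²σ²/2` (trained factorised flows
with residual per-block log-weight of standard deviation `≍ n^{−1/2}` are covered by rescaling).
[ours] -/
theorem triangularPi_loss_diag_tendsto (hm : ∀ n, Measurable (h n)) {K : ℝ} (hK : ∀ n y, |h n y| ≤ K)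
    (h0 : ∀ n, ∫ y, h n y ∂ρ n = 0) {σ2 : ℝ}
    (hσ : Tendsto (fun n : ℕ => Var[h n; ρ n]) atTop (𝓝 σ2)) (c : ℝ) :
    Tendsto (fun n : ℕ => (n : ℝ) * cgf (h n) (ρ n) (c / Real.sqrt n)) atTop (𝓝 (c ^ 2 * σ2 / 2)) := by
  have hσ' : Tendsto (fun n : ℕ => (∑ _i : Fin n, Var[h n; ρ n]) / n) atTop (𝓝 σ2) := by
    refine hσ.congr' ?_
    filter_upwards [eventually_gt_atTop 0] with n hn
    rw [Finset.sum_const, Finset.card_univ, Fintype.card_fin, nsmul_eq_mul]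
    field_simp
  have h := heteroPi_loss_diag_tendsto (ρ := fun n _ => ρ n) (h := fun n _ => h n)
    (fun n _ => hm n) (fun n _ y => hK n y) (fun n _ => h0 n) hσ' c
  refine h.congr fun n => ?_
  simp

end Triangular

end Summit.Ventures.LatticeQCDFlow.Theory2

end
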